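import Summits.CriticalPhenomena.PercolationContinuityZ3.Theorems.PercNearOneGluingNoHeavyQuantTwinMoveRefillPour
import Summits.CriticalPhenomena.PercolationContinuityZ3.Theorems.PercNearOneGluingNoHeavyQuantZeroLast
import HarnessLib

/-!
# QUANT lane R8, T-DEC, leg (III): THE TWIN MOVE LEMMA WHEN THE LOWS ABOVE THE BLOB CAN REFILL ITS VACATED SLOTS (`twinMove_of_vacatedRefill`):
# `TwinMoveDEC` at every layer `j ≥ a` with `2a < t` for every flow of `Λ` whose transferred giant mass on the lows `≥ a` covers the vacated fraction
# of the blob atom's mid routes — the residual of `TwinMoveDEC` is thereby EXACTLY typer g27's sub-case (b) (+ the layers `2a ≥ t`)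

builds on p205010 (kernel theorem, internal audit signed; external expert review pending)

Support file (`--supports stmt-CriticalPhenomena-4575`), QUANT lane seat prim-quant-arm-1 (gen 39), rung R8 of
`run/shared/lean/prim/quant/LADDER.md`.  Theorems only (no definitions), standard axioms, no sorries.  Step 2 of the two-pour competitor (memo
TWIN-MOVE-G39 §9–§10): `twinMove_refillPour` (the lows `≥ a` refill the blob atom's vacated slots) → `IsFlowAtT.pour` of everything into the zero's
vacated slots (`rho_le_rho_zero`) → `decAtT_of_zeroFreeRouting`.  Generalises `twinMove_of_blobOnGiants` (the case in which `a` sends nothing into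
mids; there the hypothesis below is trivially true).

HYPOTHESIS on the flow witness `f` of `Λ` at `τ` (with `θ = P a/Λ a = (1−z)R a/(zg + (1−z)R a)`): the transfer's giant-routed mass on the lows
`l ≥ a` — `Σ_{l > a} G_f(l) + θ·G_f(a)` on `P`'s nonzero lows — is at least `(1−θ)·Σ_{h ≤ j} f a h`.  In words: `Λ` routes into mids no more of the
blob atom than what `P` still has there plus what the lows above `a` can bring back from the giants (at gain ≥ 1, since they are cheaper than `a` in
`a`'s slots).  WHAT REMAINS OPEN of `TwinMoveDEC`: (R1) flows in which only lows `< a` could refill `a`'s vacated slots (gain `< 1`; the twins must pay)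
— by `…QuantFlowArgmin` one may first maximise the left side over the flow polytope —, and (R2) the layers with `2a ≥ t`.

* **`LawDec.twinMove_of_vacatedRefill`**.

[this work]; nothing here is cited as a published result.  The gluing rows served [cite: KozmaNitzan2024, Conjecture 3 (p. 15)]; product measure
[cite: Grimmett1999, §1.3 p. 10].
-/

noncomputable section

namespace Summit.CriticalPhenomena.PercolationContinuityZ3.Theorems

namespace Quant

open Finset

/-- the two-point law `{lo, hi; g}` (as in `…QuantLawDEC`) -/
local notation3 "TP[" lo ", " hi ", " g ", " h "]" =>
  (g : ℝ) * (if (h : ℕ) = (hi : ℕ) then (1 : ℝ) else 0) + (1 - (g : ℝ)) * (if (h : ℕ) = (lo : ℕ) then (1 : ℝ) else 0)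

namespace LawDec

/-- **TWIN MOVE WHEN THE BIG LOWS CAN REFILL THE BLOB ATOM'S VACATED SLOTS.**  See the module docstring. [this work] -/
theorem twinMove_of_vacatedRefill (y z g : ℝ) (a j N : ℕ) (R : ℕ → ℝ) (f : ℕ → ℕ → ℝ)
    (hy0 : 0 < y) (hy1 : y < 1) (hz0 : 0 ≤ z) (hz1 : z < 1) (hg0 : 0 < g) (hg1 : g ≤ 1) (ha1 : 1 ≤ a)
    (hR0 : ∀ h, 0 ≤ R h) (hRN : ∀ h, N < h → R h = 0) (hR1 : ∑ h ∈ Finset.range (N + 1), R h = 1)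
    (hta : y * (N : ℝ) ≤ (1 - z) * ∑ h ∈ Finset.range (N + 1), (h : ℝ) * R h)
    (hat : 2 * (a : ℝ) < (1 - z) * ∑ h ∈ Finset.range (N + 1), (h : ℝ) * R h) (haj : a ≤ j)
    (hf : IsFlowAtT y (z * (a : ℝ) * g + (1 - z) * ∑ h ∈ Finset.range (N + 1), (h : ℝ) * R h) j N
      (fun h => z * TP[0, a, g, h] + (1 - z) * R h) f)
    (hbig : (1 - ((1 - z) * R a) / (z * g + (1 - z) * R a)) * ∑ h ∈ Finset.range (N + 1), (if h ≤ j then f a h else 0)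
      ≤ ∑ l ∈ Finset.range (j + 1), (if a ≤ l then ∑ g' ∈ Finset.Ico (j + 1) (N + 1),
          (if (1 ≤ l ∧ 2 * (l : ℝ) < (1 - z) * ∑ h ∈ Finset.range (N + 1), (h : ℝ) * R h) then
            (z * (if l = 0 then (1 : ℝ) else 0) + (1 - z) * R l) / (z * TP[0, a, g, l] + (1 - z) * R l) * f l g' else 0) else 0)) :
    DECAtT y ((1 - z) * ∑ h ∈ Finset.range (N + 1), (h : ℝ) * R h) j N
      (fun h => z * (if h = 0 then (1 : ℝ) else 0) + (1 - z) * R h) := by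
  classical
  obtain ⟨φ₁, hφ1, hfree, hW1le⟩ :=
    twinMove_refillPour y z g a j N R f hy0 hy1 hz0 hz1 hg0 hg1 ha1 hR0 hat haj hf hbig
  obtain ⟨_, _, hcolΛ, _, _, _, _, _, hPΛa⟩ :=
    twinMove_transferFacts y z g a j N R f hy0 hy1 hz0 hz1 hg0 hg1 ha1 hR0 hat haj hf
  set S : ℝ := ∑ h ∈ Finset.range (N + 1), (h : ℝ) * R h with hS
  set t : ℝ := (1 - z) * S with ht
  set τ : ℝ := z * (a : ℝ) * g + (1 - z) * S with hτ
  set Λ : ℕ → ℝ := fun h => z * TP[0, a, g, h] + (1 - z) * R h with hΛ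
  set P : ℕ → ℝ := fun h => z * (if h = 0 then (1 : ℝ) else 0) + (1 - z) * R h with hP
  have h1z : 0 < 1 - z := by linarith
  have h1y : 0 < 1 - y := by linarith
  have ha0 : (0 : ℝ) ≤ a := Nat.cast_nonneg a
  have hane : a ≠ 0 := by omega
  have hzg : 0 ≤ z * g := mul_nonneg hz0 hg0.le
  have hzag : 0 ≤ z * (a : ℝ) * g := mul_nonneg (mul_nonneg hz0 ha0) hg0.le
  have htτ : t ≤ τ := by rw [ht, hτ]; linarith
  have ht0 : 0 < t := by rw [ht]; nlinarith
  have hτ0 : 0 < τ := lt_of_lt_of_le ht0 htτ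
  have huG : 0 < y / (1 - y) := div_pos hy0 h1y
  obtain ⟨hf0, hfsupp, hfrow, hfcol⟩ := id hf
  -- facts about `P`
  have hP0 : ∀ h, 0 ≤ P h := fun h => by simp only [hP]; split_ifs <;> nlinarith [hR0 h]
  have hPN : ∀ h, N < h → P h = 0 := fun h hh => by simp only [hP]; rw [hRN h hh, if_neg (by omega)]; ring
  have hP1 : ∑ h ∈ Finset.range (N + 1), P h = 1 := by
    simp only [hP]
    rw [Finset.sum_add_distrib, ← Finset.mul_sum, ← Finset.mul_sum, hR1, Finset.sum_ite_eq' (Finset.range (N + 1)) 0,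
      if_pos (Finset.mem_range.2 (Nat.succ_pos N))]
    ring
  have hPmean : ∑ h ∈ Finset.range (N + 1), (h : ℝ) * P h = t := by
    simp only [hP]
    have e : ∀ h : ℕ, (h : ℝ) * (z * (if h = 0 then (1 : ℝ) else 0) + (1 - z) * R h)
        = (if h = 0 then (h : ℝ) * z else 0) + (1 - z) * ((h : ℝ) * R h) := fun h => by split_ifs <;> ring
    simp_rw [e]
    rw [Finset.sum_add_distrib, ← Finset.mul_sum, Finset.sum_ite_eq' (Finset.range (N + 1)) 0, if_pos (Finset.mem_range.2 (Nat.succ_pos N))]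
    simp [ht, hS]
  have hΛ0 : Λ 0 = z * (1 - g) + (1 - z) * R 0 := by
    show z * (g * (if (0:ℕ) = a then (1:ℝ) else 0) + (1 - g) * (if (0:ℕ) = 0 then (1:ℝ) else 0)) + (1 - z) * R 0 = _
    rw [if_neg (Ne.symm hane), if_pos rfl]; ring
  have hP00 : P 0 = z + (1 - z) * R 0 := by
    show z * (if (0:ℕ) = 0 then (1:ℝ) else 0) + (1 - z) * R 0 = _
    rw [if_pos rfl]; ring
  have hpair : ∀ l h, 0 < f l h → l ≤ j ∧ 2 * (l : ℝ) < τ ∧ h ≤ N ∧ (j + 1 ≤ h ∨ τ < (l : ℝ) + h) ∧ l < h := by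
    intro l h hp
    obtain ⟨hlj, hl2, hhM, hc⟩ := hfsupp l h hp
    refine ⟨hlj, hl2, hhM, hc, ?_⟩
    rcases hc with hc | hc
    · omega
    · have : (l : ℝ) < h := by linarith
      exact_mod_cast this
  ------------------------------------------------------------------
  -- POUR 2: everything into the zero's vacated slots
  ------------------------------------------------------------------
  have h0slot : ∀ h, h ≤ j → 0 < f 0 h → h ≤ N ∧ τ < (h : ℝ) ∧ 0 < usage y τ j 0 h := by
    intro h hhj hp
    obtain ⟨_, _, hhN, hc, hlh⟩ := hpair 0 h hp
    have hc' : τ < (h : ℝ) := by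
      rcases hc with hc | hc
      · omega
      · rw [Nat.cast_zero, zero_add] at hc; exact hc
    have h2z : 2 * ((0:ℕ) : ℝ) < τ := by rw [Nat.cast_zero, mul_zero]; exact hτ0
    have hc'' : j + 1 ≤ h ∨ τ < ((0:ℕ) : ℝ) + h := Or.inr (by rw [Nat.cast_zero, zero_add]; exact hc')
    exact ⟨hhN, hc', usage_pos_of_compat y τ j 0 h hy0 hy1 h2z hlh hc''⟩
  set s2 : ℕ → ℝ := fun h => if (h ≤ j ∧ 0 < f 0 h) then usage y τ j 0 h * f 0 h else 0 with hs2
  set U2 : ℕ → ℝ := fun h => if (h ≤ j ∧ 0 < f 0 h) then usage y τ j 0 h else 1 with hU2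
  have hs20 : ∀ h, 0 ≤ s2 h := fun h => by
    simp only [hs2]; split_ifs with hc
    · exact mul_nonneg (h0slot h hc.1 hc.2).2.2.le hc.2.le
    · exact le_rfl
  have hU2p : ∀ h, 0 < U2 h := fun h => by
    simp only [hU2]; split_ifs with hc
    · exact (h0slot h hc.1 hc.2).2.2
    · exact zero_lt_one
  have hs2g : ∀ h, 0 < s2 h → h ≤ j ∧ 0 < f 0 h := by
    intro h hp; simp only [hs2] at hp; by_contra hc; rw [if_neg hc] at hp; exact lt_irrefl _ hp
  have hslot2 : ∀ h, 0 < s2 h → h ≤ j ∧ h ≤ N ∧ t < (h : ℝ) := by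
    intro h hp
    obtain ⟨hhj, hf0h⟩ := hs2g h hp
    obtain ⟨hhN, hτh, _⟩ := h0slot h hhj hf0h
    exact ⟨hhj, hhN, lt_of_le_of_lt htτ hτh⟩
  have hspare2 : ∀ h, 0 < s2 h → ∑ l ∈ Finset.range (j + 1), usage y t j l h * φ₁ l h + s2 h ≤ (fun h => if h = 0 then 0 else P h) h := by
    intro h hp
    obtain ⟨hhj, hf0h⟩ := hs2g h hp
    obtain ⟨hhN, hτh, _⟩ := h0slot h hhj hf0h
    have hng : ¬ (j + 1 ≤ h) := by omega
    have hfr := hfree h hng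
    obtain ⟨hc1, hc2⟩ := hcolΛ h hhN (Or.inr (by linarith))
    have hs2v : s2 h = usage y τ j 0 h * f 0 h := by simp only [hs2, if_pos (And.intro hhj hf0h)]
    have hh0 : h ≠ 0 := by rintro rfl; rw [Nat.cast_zero] at hτh; linarith
    show _ ≤ (if h = 0 then 0 else P h)
    rw [if_neg hh0, ← hc2, hs2v]
    linarith
  have hrate2 : ∀ l h, 0 < s2 h → l ≤ j → 2 * (l : ℝ) < t → usage y t j l h ≤ U2 h := by
    intro l h hp _ hlow
    obtain ⟨hhj, hf0h⟩ := hs2g h hp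
    obtain ⟨_, hτh, _⟩ := h0slot h hhj hf0h
    have hUv : U2 h = usage y τ j 0 h := by simp only [hU2, if_pos (And.intro hhj hf0h)]
    rw [hUv]
    have h2z : 2 * ((0:ℕ) : ℝ) < τ := by rw [Nat.cast_zero, mul_zero]; exact hτ0
    have hc0 : τ < ((0:ℕ) : ℝ) + h := by rw [Nat.cast_zero, zero_add]; exact hτh
    have h2h : τ ≤ 2 * (h : ℝ) := by linarith
    exact usage_le_of_rho_le y t τ j l 0 h hy0 hy1 hhj h2z hc0 (rho_le_rho_zero t τ l h htτ hlow h2h)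
  set F0 : ℝ := ∑ h ∈ Finset.range (N + 1), (if h ≤ j then f 0 h else 0) with hF0
  have hF2v : ∑ h ∈ Finset.range (N + 1), s2 h / U2 h = F0 := by
    refine Finset.sum_congr rfl fun h _ => ?_
    simp only [hs2, hU2]
    by_cases hc : (h ≤ j ∧ 0 < f 0 h)
    · rw [if_pos hc, if_pos hc, if_pos hc.1]; field_simp [(h0slot h hc.1 hc.2).2.2.ne']
    · rw [if_neg hc, if_neg hc, zero_div]
      by_cases hhj : h ≤ j
      · rw [if_pos hhj]; exact (le_antisymm (not_lt.1 fun hp => hc ⟨hhj, hp⟩) (hf0 0 h)).symm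
      · rw [if_neg hhj]
  have hF00 : 0 ≤ F0 := Finset.sum_nonneg fun h _ => by split_ifs; exacts [hf0 0 h, le_rfl]
  set W1 : ℝ := ∑ l ∈ Finset.range (j + 1), ∑ g' ∈ Finset.Ico (j + 1) (N + 1), φ₁ l g' with hW1
  have hW10 : 0 ≤ W1 := Finset.sum_nonneg fun l _ => Finset.sum_nonneg fun g' _ => hφ1.1 l g'
  set κ2 : ℝ := if W1 ≤ F0 then 1 else F0 / W1 with hκ2
  have hκ20 : 0 ≤ κ2 := by simp only [hκ2]; split_ifs; exacts [zero_le_one, div_nonneg hF00 hW10]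
  have hκ21 : κ2 ≤ 1 := by
    simp only [hκ2]; split_ifs with hc
    · exact le_rfl
    · exact (div_le_one (lt_of_le_of_lt hF00 (not_le.1 hc))).2 (not_le.1 hc).le
  have hκ2F : κ2 * W1 ≤ ∑ h ∈ Finset.range (N + 1), s2 h / U2 h := by
    rw [hF2v]; simp only [hκ2]; split_ifs with hc
    · rw [one_mul]; exact hc
    · rw [div_mul_cancel₀ _ (ne_of_gt (lt_of_le_of_lt hF00 (not_le.1 hc)))]
  obtain ⟨φ2, hφ2, hW2⟩ := hφ1.pour hy0 hy1 s2 U2 hs20 hU2p hslot2 hspare2 hrate2 κ2 hκ20 hκ21 hκ2F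
  ------------------------------------------------------------------
  -- ZERO-LAST
  ------------------------------------------------------------------
  have htaN : y * (N : ℝ) ≤ t := by rw [ht]; exact hta
  refine decAtT_of_zeroFreeRouting y t j N P φ2 hy0 hy1 ht0 hP0 hPN hP1 htaN (by rw [hPmean, hP1, mul_one]) hφ2 ?_
  by_cases hWF : W1 ≤ F0
  · left; rw [hW2, ← hW1]; simp only [hκ2, if_pos hWF]; ring
  · right
    have hW1pos : 0 < W1 := lt_of_le_of_lt hF00 (not_le.1 hWF)
    have hW2v : ∑ l ∈ Finset.range (j + 1), ∑ g' ∈ Finset.Ico (j + 1) (N + 1), φ2 l g' = W1 - F0 := by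
      rw [hW2, ← hW1]; simp only [hκ2, if_neg hWF]
      rw [sub_mul, div_mul_cancel₀ _ hW1pos.ne', one_mul]
    rw [hW2v]
    set Gf : ℕ → ℝ := fun l => ∑ g' ∈ Finset.Ico (j + 1) (N + 1), f l g' with hGf
    -- the zero row of `f`
    have hzrow : Λ 0 = F0 + Gf 0 := by
      have hGfr : Gf 0 = ∑ h ∈ Finset.range (N + 1), (if j + 1 ≤ h then f 0 h else 0) := by
        simp only [hGf]; rw [sum_range_ite_ge_eq_Ico]
      rw [hGfr, hF0, ← Finset.sum_add_distrib, ← hfrow 0 (Nat.zero_le _) (by rw [Nat.cast_zero, mul_zero]; exact hτ0)]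
      refine Finset.sum_congr rfl fun h _ => ?_
      by_cases hhj : h ≤ j
      · rw [if_pos hhj, if_neg (by omega), add_zero]
      · rw [if_neg hhj, if_pos (by omega), zero_add]
    -- the giants' capacity in `Λ`
    have hgiants : y / (1 - y) * ∑ l ∈ Finset.range (j + 1), Gf l ≤ ∑ g' ∈ Finset.Ico (j + 1) (N + 1), P g' := by
      have hper : ∀ g' ∈ Finset.Ico (j + 1) (N + 1), y / (1 - y) * ∑ l ∈ Finset.range (j + 1), f l g' ≤ P g' := by
        intro g' hg'
        obtain ⟨hg1, hg2⟩ := Finset.mem_Ico.1 hg'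
        obtain ⟨hc, hΛPg⟩ := hcolΛ g' (by omega) (Or.inl hg1)
        have e : ∑ l ∈ Finset.range (j + 1), usage y τ j l g' * f l g' = y / (1 - y) * ∑ l ∈ Finset.range (j + 1), f l g' := by
          rw [Finset.mul_sum]; exact Finset.sum_congr rfl fun l _ => by rw [usage_giant_eq y τ j l g' hg1]
        rw [e, hΛPg] at hc; exact hc
      calc y / (1 - y) * ∑ l ∈ Finset.range (j + 1), Gf l
          = ∑ g' ∈ Finset.Ico (j + 1) (N + 1), y / (1 - y) * ∑ l ∈ Finset.range (j + 1), f l g' := by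
            simp only [hGf]; rw [Finset.sum_comm, Finset.mul_sum]
        _ ≤ ∑ g' ∈ Finset.Ico (j + 1) (N + 1), P g' := Finset.sum_le_sum hper
    have hP0eq : P 0 = F0 + Gf 0 + z * g := by
      have e : P 0 = Λ 0 + z * g := by rw [hP00, hΛ0]; ring
      rw [e, hzrow]
    have hW1le' : W1 ≤ (∑ l ∈ Finset.range (j + 1), Gf l) - Gf 0 - z * g := hW1le
    calc y / (1 - y) * (P 0 + (W1 - F0))
        ≤ y / (1 - y) * ∑ l ∈ Finset.range (j + 1), Gf l :=
          mul_le_mul_of_nonneg_left (by rw [hP0eq]; linarith) huG.le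
      _ ≤ ∑ g' ∈ Finset.Ico (j + 1) (N + 1), P g' := hgiants

end LawDec

end Quant

end Summit.CriticalPhenomena.PercolationContinuityZ3.Theorems
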